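/-
Copyright (c) 2026 the pub-hodgecm-mathlib formalisation cell (harness21).  Prover seat hodgecm-mathlib-K2E3-p21 (g3), HCML Track B «K2-LIT» (build stream 29),
h413 = `stmt-HodgeConjecture-24833`, line `K2_E3_EllipticInputs`, unit U12 «Characters», socket #11 road (11-SC), letter (SC-an): HARISH-CHANDRA'S THEOREM 20
«cusp-form cancellation», DISCHARGE of the abstract hypotheses of ★ (T20-e2) `K2E3CuspFormCancellationHeights` at the model `U(σ, Φ₃)(K)`, FILE 1 «THE DIAGONAL TORUS»:
heights of torus elements, the `A⁺ ∕ A⁻` dichotomy, and the entrywise conjugation bounds (line lead K2E3-p20 (g3); split agreed with K2E3-p14 (g3) `K2/STATUS.md`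
2026-09-04T01:52Z).  2026-09-04.
-/
import Summits.HodgeConjecture.HodgeConjecture.Theorems.K2E3IwahoriFactorisedLevelU3   -- ★ (T20-c) (this seat): levels `K_γ`, `conj_mem_congruenceGL_of_valBound`; brings ★ `borelTriple`, `weylLongU`, `congruenceGL`, `ValBound`, the `Valued`∕`ValuativeRel` bridge, ★ `CartanUnique`
import HarnessLib

/-!
# h413 ∕ Track B «K2-LIT», (SC-an) Theorem-20 line — DISCHARGE FILE 1: THE DIAGONAL TORUS OF `U(σ, Φ₃)(K)` IN THE HEIGHT-BALL CURRENCY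
# (heights `a ∈ Ω_h ⟺ |ϖ^h d₀|, |ϖ^h d₀⁻¹| ≤ 1`; `A⁺ = {|d₀| ≥ 1}`, `A⁻ = {|d₀| ≤ 1}`; `a ∉ Ω_h ⇒ |d₀^{∓1}| ≤ |ϖ|^{h+1}`; the conjugated entries `d_i⁻¹ n_{ij} d_j`)
# (Harish-Chandra 1970, Part VII §8 Lemmas 54–55 pp. 82–83; Rogawski 1990 §1.10)

Cell `pub/hodgecm-mathlib`, crux H413 = `stmt-HodgeConjecture-24833`, route of record `HCCMUnconditional`; chair K2-lead (g0), dealer K2E3-plan (g2), line lead K2E3-p20 (g3).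
THEOREMS ONLY (no `def`, no `instance`, no `notation`, no named-fact hypothesis, no `sorry`); lane `--supports stmt-HodgeConjecture-24833 --as helper`, count-neutral.

PURPOSE.  ★ (T20-e2) p856608 `K2E3CuspFormCancellationHeights.cuspForm_trichotomy_*` is an ABSTRACT group statement whose hypotheses (`hAcover`, `hplusV∕C`, `hminusV∕C`,
`h54`, `hT`, `hnorm`, …) must be discharged at the one-place model `U = U(σ, Φ₃)(K)` of the organ's `U(2,1)` (then transported to the CM group by (T20-f)).  THIS FILE does
the TORUS ALGEBRA: `K` a field with compatible `Valued K ℤᵐ⁰` ∕ `ValuativeRel` structures, `σ : K →+* K` ISOMETRIC (`|σ x| = |x|`; at the CM place ★ `valued_galAdicCompletionMap`),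
`J = Φ₃`, a diagonal unitary `a = diag(d)` (`σ(d_{2−i}) d_i = 1`, ★ `glDiagonal_mem_unitaryGroupOfForm_antidiagonal_iff`), a uniformiser `ϖ`, and the height-ball
membership of ★ p856390 (`g ∈ Ω_m ⟺ ϖ^m g, ϖ^m g⁻¹ integral`) taken as a HYPOTHESIS `hmem` on an abstract `Ω : ℕ → Set U` (so (T20-f) feeds the `Ω` it obtains).
* §1 **`v_torus_mid_eq_one`** (`|d₁| = 1`), **`v_torus_last_eq_inv`** (`|d₂| = |d₀|⁻¹`).
* §2 entries: `diagonal_mul_mul_diagonal_apply` (`(diag d · N · diag e)_{ij} = d_i N_{ij} e_j`), `coe_inv_glDiagonal`.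
* §3 HEIGHTS OF TORUS ELEMENTS: **`diag_mem_heightBall_iff`** (`a ∈ Ω_h ↔ |ϖ^h d₀| ≤ 1 ∧ |ϖ^h d₀⁻¹| ≤ 1`); DISCRETENESS **`v_inv_le_pow_succ_of_not_mem`** (`|d₀| ≥ 1`, `a ∉ Ω_h ⇒
  |d₀⁻¹| ≤ |ϖ^{h+1}|`) and **`v_le_pow_succ_of_not_mem`** (`|d₀| ≤ 1`, `a ∉ Ω_h ⇒ |d₀| ≤ |ϖ^{h+1}|`) — print's `ν(a)`; `v_ratio_le_*` (the three root values above∕below the diagonal).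
* §4 **`valuation_mul_le_pow_of_le`**: the LEVEL ESTIMATE `|ϖ^c x| ≤ 1 ∧ |r| ≤ |ϖ^{h+1}| ∧ j + c ≤ h+1 ⇒ valuation(x·r) ≤ valuation(ϖ)^j` (in the `ValuativeRel` currency of ★ `congruenceGL`)
  and `valuation_mul_le_of_v_le_one` (`|r| ≤ 1 ⇒ valuation(x·r) ≤ γ` whenever `valuation x ≤ γ`: transport of a `ValBound` along a non-expanding root value).
FILE 2 (`K2E3CuspFormCancellationU3Inputs`) assembles these into the literal hypotheses of (T20-e2).

HONEST LABEL.  HC_CM is proved only modulo the 7 printed citations (2 remaining named inputs: hLiu418 = `stmt-HodgeConjecture-24832`, h413 = `stmt-HodgeConjecture-24833`)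
until rung 0 closes; count-neutral helper (valuation bookkeeping only).

## References
* [HarishChandra1970] Harish-Chandra (notes by G. van Dijk), *Harmonic Analysis on Reductive p-adic Groups*, LNM 162 (1970), Part VII §2 p. 69 (`‖x‖`, `σ(x)`), §8 Lemmas 54–55
  pp. 82–83 (`(a⁻¹n′a)_{ij} = a_i⁻¹a_j n′_{ij}`, `|ξ_α(a)| = q^{ν(a)α(t(a))}`).
* [Rogawski1990] J. D. Rogawski, *Automorphic Representations of Unitary Groups in Three Variables*, Ann. of Math. Stud. 123 (1990), §1.10 p. 9 (`M = {d(α, β, ᾱ⁻¹)}`).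
* [Serre1979] J.-P. Serre, *Local Fields*, GTM 67 (1979), Ch. I §1 (discrete valuations: `x = π^n u`).
-/

set_option autoImplicit false
set_option linter.dupNamespace false  -- the mandated namespace repeats the single-problem summit's segment (`HodgeConjecture.HodgeConjecture`)

noncomputable section

open scoped MatrixGroups WithZero
open ValuativeRel Matrix
open Literature.NumberTheory.Automorphic Literature.NumberTheory.Automorphic.UnitaryGroup

namespace Summit.HodgeConjecture.HodgeConjecture.Cruxes.H413.K2E3CuspFormCancellationU3Torus

/-! ## §1 Valuations of the diagonal entries of a torus element of `U(σ, Φ₃)` -/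

section TorusVal

variable {K : Type*} [Field K] [Valued K ℤᵐ⁰] (σ : K →+* K) (hσv : ∀ x, Valued.v (σ x) = Valued.v x)

include hσv in
/-- **`|d₁| = 1`**: for a diagonal unitary `d(d₀, d₁, d₂)` of `U(σ, Φ₃)` (`σ(d_{2−i}) d_i = 1`) the middle entry has `σ(d₁) d₁ = 1`, so `|d₁|² = 1` (`σ` isometric).
[cite: Rogawski1990, §1.10 p. 9] -/
theorem v_torus_mid_eq_one {d : Fin 3 → Kˣ} (hd : ∀ i : Fin 3, σ (d (Fin.rev i) : K) * (d i : K) = 1) : Valued.v (d 1 : K) = 1 := by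
  have h := hd 1
  have hrev : Fin.rev (1 : Fin 3) = 1 := by decide
  rw [hrev] at h
  have h2 : Valued.v (d 1 : K) * Valued.v (d 1 : K) = 1 := by
    have := congrArg Valued.v h
    rwa [map_mul, hσv, map_one] at this
  -- `x · x = 1 ⇒ x = 1` in the linearly ordered value group (★ `UnitaryLatticeTree.eq_one_of_mul_self_eq_one`, re-derived inline to keep the import closure light)
  rcases lt_trichotomy (Valued.v (d 1 : K)) 1 with hx | hx | hx
  · exact absurd h2 (mul_lt_one' hx hx).ne
  · exact hx
  · exact absurd h2 (one_lt_mul'' hx hx).ne'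

include hσv in
/-- **`|d₂| = |d₀|⁻¹`**: `σ(d₀) d₂ = 1` (the relation at `i = 2`, `rev 2 = 0`). [cite: Rogawski1990, §1.10 p. 9] -/
theorem v_torus_last_eq_inv {d : Fin 3 → Kˣ} (hd : ∀ i : Fin 3, σ (d (Fin.rev i) : K) * (d i : K) = 1) :
    Valued.v (d 2 : K) = (Valued.v (d 0 : K))⁻¹ := by
  have h := hd 2
  have hrev : Fin.rev (2 : Fin 3) = 0 := by decide
  rw [hrev] at h
  have h2 : Valued.v (d 0 : K) * Valued.v (d 2 : K) = 1 := by
    have := congrArg Valued.v h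
    rwa [map_mul, hσv, map_one] at this
  exact eq_inv_of_mul_eq_one_right h2

end TorusVal

/-! ## §2 Entries of diagonal conjugates -/

section Entries

variable {K : Type*} [Field K] {n : Type*} [Fintype n] [DecidableEq n]

/-- `(diag(d) · N · diag(e))_{ij} = d_i · N_{ij} · e_j`. [cite: HarishChandra1970, Part VII §8 p. 82] -/
theorem diagonal_mul_mul_diagonal_apply (d e : n → K) (N : Matrix n n K) (i j : n) :
    (diagonal d * N * diagonal e) i j = d i * N i j * e j := by
  rw [mul_diagonal, diagonal_mul]

/-- The matrix of `(diag d)⁻¹` in `GL`: `((glDiagonal d)⁻¹)_{ij} = diag(d⁻¹)_{ij}`. [cite: Rogawski1990, §1.10 p. 9] -/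
theorem coe_inv_glDiagonal {m : ℕ} (d : Fin m → Kˣ) :
    (((glDiagonal m K d)⁻¹ : GL (Fin m) K) : Matrix (Fin m) (Fin m) K) = diagonal fun i => ((d i : K))⁻¹ := by
  rw [← map_inv, coe_glDiagonal]
  congr 1
  funext i
  simp

end Entries

/-! ## §3 Heights of torus elements, the `A⁺ ∕ A⁻` dichotomy, discreteness -/

section Heights

variable {K : Type*} [Field K] [Valued K ℤᵐ⁰] (σ : K →+* K) (hσv : ∀ x, Valued.v (σ x) = Valued.v x)
  {J : Matrix (Fin 3) (Fin 3) K} (hJ : J = (StdForm.antidiagonal 3).over K) {ϖ : K} (hϖ : Valued.v ϖ = WithZero.exp (-1 : ℤ))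
  (Ω : ℕ → Set ↥(unitaryGroupOfForm σ J))
  (hmem : ∀ (m : ℕ) (g : ↥(unitaryGroupOfForm σ J)), g ∈ Ω m ↔
    (∀ i j, Valued.v (ϖ ^ m * ((g : GL (Fin 3) K) : Matrix (Fin 3) (Fin 3) K) i j) ≤ 1) ∧
      ∀ i j, Valued.v (ϖ ^ m * (((g : GL (Fin 3) K)⁻¹ : GL (Fin 3) K) : Matrix (Fin 3) (Fin 3) K) i j) ≤ 1)

omit [Valued K ℤᵐ⁰] in
include hJ in
/-- A diagonal element of `U(σ, Φ₃)` satisfies the unitarity relations `σ(d_{2−i}) d_i = 1`. [cite: Rogawski1990, §1.10 p. 9] -/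
theorem torus_rel {a : ↥(unitaryGroupOfForm σ J)} {d : Fin 3 → Kˣ} (hd : glDiagonal 3 K d = (a : GL (Fin 3) K)) :
    ∀ i : Fin 3, σ (d (Fin.rev i) : K) * (d i : K) = 1 := by
  have ha : glDiagonal 3 K d ∈ unitaryGroupOfForm σ ((StdForm.antidiagonal 3).over K) := by rw [hd, ← hJ]; exact a.2
  exact (glDiagonal_mem_unitaryGroupOfForm_antidiagonal_iff σ 3 d).1 ha

include hσv hJ hϖ hmem in
/-- **HEIGHT OF A TORUS ELEMENT**: for `a = diag(d) ∈ U(σ, Φ₃)`, `a ∈ Ω_h ↔ |ϖ^h d₀| ≤ 1 ∧ |ϖ^h d₀⁻¹| ≤ 1` (the entries of `a^{±1}` are `d₀^{±1}`, `d₁^{±1}` with `|d₁| = 1`,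
`d₂^{±1}` with `|d₂| = |d₀|⁻¹`, and zeros; print's `σ(a) = |ord d₀|`). [cite: HarishChandra1970, Part VII §2 p. 69] [cite: Rogawski1990, §1.10 p. 9] -/
theorem diag_mem_heightBall_iff {a : ↥(unitaryGroupOfForm σ J)} {d : Fin 3 → Kˣ} (hd : glDiagonal 3 K d = (a : GL (Fin 3) K)) (h : ℕ) :
    a ∈ Ω h ↔ Valued.v (ϖ ^ h * (d 0 : K)) ≤ 1 ∧ Valued.v (ϖ ^ h * (d 0 : K)⁻¹) ≤ 1 := by
  have hrel := torus_rel σ hJ hd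
  have h1 : Valued.v (d 1 : K) = 1 := v_torus_mid_eq_one σ hσv hrel
  have h2 : Valued.v (d 2 : K) = (Valued.v (d 0 : K))⁻¹ := v_torus_last_eq_inv σ hσv hrel
  have hmat : ((a : GL (Fin 3) K) : Matrix (Fin 3) (Fin 3) K) = diagonal fun i => (d i : K) := by rw [← hd, coe_glDiagonal]
  have hinv : (((a : GL (Fin 3) K)⁻¹ : GL (Fin 3) K) : Matrix (Fin 3) (Fin 3) K) = diagonal fun i => ((d i : K))⁻¹ := by
    rw [← hd, coe_inv_glDiagonal]
  have hϖh : Valued.v (ϖ ^ h) ≤ 1 := by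
    rw [CartanUnique.v_uniformizer_pow hϖ h, ← WithZero.exp_zero, WithZero.exp_le_exp]; omega
  rw [hmem, hmat, hinv]
  constructor
  · rintro ⟨hA, hB⟩
    refine ⟨?_, ?_⟩
    · have := hA 0 0; rwa [diagonal_apply_eq] at this
    · have := hB 0 0; rwa [diagonal_apply_eq] at this
  · rintro ⟨hA, hB⟩
    have hA' : Valued.v (ϖ ^ h) * Valued.v (d 0 : K) ≤ 1 := by rw [← map_mul]; exact hA
    have hB' : Valued.v (ϖ ^ h) * (Valued.v (d 0 : K))⁻¹ ≤ 1 := by rw [← map_inv₀, ← map_mul]; exact hB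
    refine ⟨fun i j => ?_, fun i j => ?_⟩
    · by_cases hij : i = j
      · subst hij
        rw [diagonal_apply_eq, map_mul]
        fin_cases i
        · rw [← map_mul]; exact hA
        · show Valued.v (ϖ ^ h) * Valued.v (d 1 : K) ≤ 1
          rw [h1, mul_one]; exact hϖh
        · show Valued.v (ϖ ^ h) * Valued.v (d 2 : K) ≤ 1
          rw [h2]; exact hB'
      · rw [diagonal_apply_ne _ hij, mul_zero, map_zero]; exact zero_le
    · by_cases hij : i = j
      · subst hij
        rw [diagonal_apply_eq, map_mul, map_inv₀]
        fin_cases i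
        · show Valued.v (ϖ ^ h) * (Valued.v (d 0 : K))⁻¹ ≤ 1
          exact hB'
        · show Valued.v (ϖ ^ h) * (Valued.v (d 1 : K))⁻¹ ≤ 1
          rw [h1, inv_one, mul_one]; exact hϖh
        · show Valued.v (ϖ ^ h) * (Valued.v (d 2 : K))⁻¹ ≤ 1
          rw [h2, inv_inv]; exact hA'
      · rw [diagonal_apply_ne _ hij, mul_zero, map_zero]; exact zero_le

include hϖ in
/-- **DISCRETENESS**: if `1 ≤ |t|` and `1 < |ϖ^h t|` then `|t⁻¹| ≤ |ϖ^{h+1}|` (`|t| = q^e` with `e > h`, so `e ≥ h + 1` — print's `ν(a) ≥ …` as an integer).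
[cite: Serre1979, Ch. I §1] [cite: HarishChandra1970, Part VII §8 Lemma 55 p. 83] -/
theorem v_inv_le_pow_succ_of_one_lt {t : K} (ht0 : t ≠ 0) {h : ℕ} (hlt : 1 < Valued.v (ϖ ^ h * t)) :
    Valued.v t⁻¹ ≤ Valued.v (ϖ ^ (h + 1)) := by
  have hvt : Valued.v t ≠ 0 := (Valuation.ne_zero_iff _).2 ht0
  rw [map_mul, CartanUnique.v_uniformizer_pow hϖ h, ← WithZero.exp_log hvt, ← WithZero.exp_add, ← WithZero.exp_zero, WithZero.exp_lt_exp] at hlt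
  rw [map_inv₀, CartanUnique.v_uniformizer_pow hϖ (h + 1), ← WithZero.exp_log hvt, ← WithZero.exp_neg, WithZero.exp_le_exp]
  push_cast
  omega

include hσv hJ hϖ hmem in
/-- **`A⁺` FAR OUT CONTRACTS BY `h+1` LEVELS**: for `a = diag(d) ∈ U(σ,Φ₃)` with `1 ≤ |d₀|` and `a ∉ Ω_h`: `|d₀⁻¹| ≤ |ϖ^{h+1}|` (the condition failing in `diag_mem_heightBall_iff`
is `|ϖ^h d₀| ≤ 1`). [cite: HarishChandra1970, Part VII §8 Lemma 55 p. 83] -/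
theorem v_inv_le_pow_succ_of_not_mem {a : ↥(unitaryGroupOfForm σ J)} {d : Fin 3 → Kˣ} (hd : glDiagonal 3 K d = (a : GL (Fin 3) K))
    (hplus : 1 ≤ Valued.v (d 0 : K)) {h : ℕ} (hah : a ∉ Ω h) : Valued.v ((d 0 : K))⁻¹ ≤ Valued.v (ϖ ^ (h + 1)) := by
  refine v_inv_le_pow_succ_of_one_lt hϖ (d 0).ne_zero (lt_of_not_ge fun hle => hah ?_)
  refine (diag_mem_heightBall_iff σ hσv hJ hϖ Ω hmem hd h).2 ⟨hle, ?_⟩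
  rw [map_mul, map_inv₀]
  have hϖh : Valued.v (ϖ ^ h) ≤ 1 := by
    rw [CartanUnique.v_uniformizer_pow hϖ h, ← WithZero.exp_zero, WithZero.exp_le_exp]; omega
  calc Valued.v (ϖ ^ h) * (Valued.v (d 0 : K))⁻¹ ≤ 1 * 1 := mul_le_mul' hϖh (inv_le_one_of_one_le₀ hplus)
    _ = 1 := one_mul 1

include hσv hJ hϖ hmem in
/-- **`A⁻` FAR OUT CONTRACTS BY `h+1` LEVELS**: for `a = diag(d)` with `|d₀| ≤ 1` and `a ∉ Ω_h`: `|d₀| ≤ |ϖ^{h+1}|`. [cite: HarishChandra1970, Part VII §8 Lemma 55 p. 83] -/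
theorem v_le_pow_succ_of_not_mem {a : ↥(unitaryGroupOfForm σ J)} {d : Fin 3 → Kˣ} (hd : glDiagonal 3 K d = (a : GL (Fin 3) K))
    (hminus : Valued.v (d 0 : K) ≤ 1) {h : ℕ} (hah : a ∉ Ω h) : Valued.v (d 0 : K) ≤ Valued.v (ϖ ^ (h + 1)) := by
  have h0 : (d 0 : K)⁻¹ ≠ 0 := inv_ne_zero (d 0).ne_zero
  have := v_inv_le_pow_succ_of_one_lt hϖ h0 (h := h) (lt_of_not_ge fun hle => hah ?_)
  · rwa [inv_inv] at this
  refine (diag_mem_heightBall_iff σ hσv hJ hϖ Ω hmem hd h).2 ⟨?_, hle⟩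
  rw [map_mul]
  have hϖh : Valued.v (ϖ ^ h) ≤ 1 := by
    rw [CartanUnique.v_uniformizer_pow hϖ h, ← WithZero.exp_zero, WithZero.exp_le_exp]; omega
  calc Valued.v (ϖ ^ h) * Valued.v (d 0 : K) ≤ 1 * 1 := mul_le_mul' hϖh hminus
    _ = 1 := one_mul 1

include hσv hJ in
/-- The three root values ABOVE the diagonal for `A⁺`: if `1 ≤ |d₀|` then `|d_i⁻¹ d_j| ≤ |d₀⁻¹|` for `i < j` (values `|d₀|⁻¹, |d₀|⁻², |d₀|⁻¹`).
[cite: HarishChandra1970, Part VII §8 p. 82] -/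
theorem v_ratio_le_inv_of_lt {a : ↥(unitaryGroupOfForm σ J)} {d : Fin 3 → Kˣ} (hd : glDiagonal 3 K d = (a : GL (Fin 3) K))
    (hplus : 1 ≤ Valued.v (d 0 : K)) {i j : Fin 3} (hij : i < j) :
    Valued.v (((d i : K))⁻¹ * (d j : K)) ≤ Valued.v ((d 0 : K))⁻¹ := by
  have hrel := torus_rel σ hJ hd
  have h1 : Valued.v (d 1 : K) = 1 := v_torus_mid_eq_one σ hσv hrel
  have h2 : Valued.v (d 2 : K) = (Valued.v (d 0 : K))⁻¹ := v_torus_last_eq_inv σ hσv hrel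
  have hle : (Valued.v (d 0 : K))⁻¹ ≤ 1 := inv_le_one_of_one_le₀ hplus
  rw [map_mul, map_inv₀, map_inv₀]
  fin_cases i <;> fin_cases j <;> simp at hij
  · show (Valued.v (d 0 : K))⁻¹ * Valued.v (d 1 : K) ≤ (Valued.v (d 0 : K))⁻¹
    rw [h1, mul_one]
  · show (Valued.v (d 0 : K))⁻¹ * Valued.v (d 2 : K) ≤ (Valued.v (d 0 : K))⁻¹
    rw [h2]; exact mul_le_of_le_one_right' hle
  · show (Valued.v (d 1 : K))⁻¹ * Valued.v (d 2 : K) ≤ (Valued.v (d 0 : K))⁻¹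
    rw [h1, h2, inv_one, one_mul]

include hσv hJ in
/-- The three root values BELOW the diagonal for `A⁻`: if `|d₀| ≤ 1` then `|d_i⁻¹ d_j| ≤ |d₀|` for `j < i` (values `|d₀|, |d₀|², |d₀|`).
[cite: HarishChandra1970, Part VII §8 p. 82] -/
theorem v_ratio_le_of_gt {a : ↥(unitaryGroupOfForm σ J)} {d : Fin 3 → Kˣ} (hd : glDiagonal 3 K d = (a : GL (Fin 3) K))
    (hminus : Valued.v (d 0 : K) ≤ 1) {i j : Fin 3} (hji : j < i) :
    Valued.v (((d i : K))⁻¹ * (d j : K)) ≤ Valued.v (d 0 : K) := by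
  have hrel := torus_rel σ hJ hd
  have h1 : Valued.v (d 1 : K) = 1 := v_torus_mid_eq_one σ hσv hrel
  have h2 : Valued.v (d 2 : K) = (Valued.v (d 0 : K))⁻¹ := v_torus_last_eq_inv σ hσv hrel
  rw [map_mul, map_inv₀]
  fin_cases i <;> fin_cases j <;> simp at hji
  · show (Valued.v (d 1 : K))⁻¹ * Valued.v (d 0 : K) ≤ Valued.v (d 0 : K)
    rw [h1, inv_one, one_mul]
  · show (Valued.v (d 2 : K))⁻¹ * Valued.v (d 0 : K) ≤ Valued.v (d 0 : K)
    rw [h2, inv_inv]; exact mul_le_of_le_one_left' hminus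
  · show (Valued.v (d 2 : K))⁻¹ * Valued.v (d 1 : K) ≤ Valued.v (d 0 : K)
    rw [h2, inv_inv, h1, mul_one]

include hσv hJ in
/-- `A⁺` does NOT expand below the diagonal: `1 ≤ |d₀|`, `j < i ⇒ |d_i d_j⁻¹| ≤ 1` (print: `(N̄ ∩ K)^a ⊂ ω₀`). [cite: HarishChandra1970, Part VII §8 p. 81] -/
theorem v_ratio_le_one_of_gt {a : ↥(unitaryGroupOfForm σ J)} {d : Fin 3 → Kˣ} (hd : glDiagonal 3 K d = (a : GL (Fin 3) K))
    (hplus : 1 ≤ Valued.v (d 0 : K)) {i j : Fin 3} (hji : j < i) :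
    Valued.v ((d i : K) * ((d j : K))⁻¹) ≤ 1 := by
  have h := v_ratio_le_inv_of_lt σ hσv hJ hd hplus hji
  have hle : (Valued.v (d 0 : K))⁻¹ ≤ 1 := inv_le_one_of_one_le₀ hplus
  have e : (d i : K) * ((d j : K))⁻¹ = (((d j : K))⁻¹ * (d i : K)) := mul_comm _ _
  rw [e]
  rw [map_inv₀] at h
  exact h.trans hle

include hσv hJ in
/-- `A⁻` does NOT expand above the diagonal: `|d₀| ≤ 1`, `i < j ⇒ |d_i d_j⁻¹| ≤ 1`. [cite: HarishChandra1970, Part VII §8 p. 81] -/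
theorem v_ratio_le_one_of_lt {a : ↥(unitaryGroupOfForm σ J)} {d : Fin 3 → Kˣ} (hd : glDiagonal 3 K d = (a : GL (Fin 3) K))
    (hminus : Valued.v (d 0 : K) ≤ 1) {i j : Fin 3} (hij : i < j) :
    Valued.v ((d i : K) * ((d j : K))⁻¹) ≤ 1 := by
  have h := v_ratio_le_of_gt σ hσv hJ hd hminus hij
  have e : (d i : K) * ((d j : K))⁻¹ = (((d j : K))⁻¹ * (d i : K)) := mul_comm _ _
  rw [e]
  exact h.trans hminus

end Heights

/-! ## §4 The level estimate in the `ValuativeRel` currency of ★ `congruenceGL` -/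

section Level

variable {K : Type*} [Field K] [Valued K ℤᵐ⁰] [ValuativeRel K] [(Valued.v : Valuation K ℤᵐ⁰).Compatible] {ϖ : K} (hϖ : Valued.v ϖ = WithZero.exp (-1 : ℤ))

include hϖ in
/-- **THE LEVEL ESTIMATE** (Lemma 55 entrywise): if `|ϖ^c x| ≤ 1` (an entry of an element of `Ω_c`), `|r| ≤ |ϖ^{h+1}|` (a contracting root value) and `j + c ≤ h + 1`, then
`valuation(x · r) ≤ valuation(ϖ)^j` — the entry bound of membership in the level `K_{|ϖ|^j}` (★ `congruenceGL`). [cite: HarishChandra1970, Part VII §8 Lemma 55 p. 83] -/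
theorem valuation_mul_le_pow_of_le {x r : K} {c h j : ℕ} (hx : Valued.v (ϖ ^ c * x) ≤ 1) (hr : Valued.v r ≤ Valued.v (ϖ ^ (h + 1)))
    (hjc : j + c ≤ h + 1) : valuation K (x * r) ≤ valuation K ϖ ^ j := by
  have hϖ0 : Valued.v ϖ ≠ 0 := by rw [hϖ]; exact WithZero.exp_ne_zero
  have hϖ1 : Valued.v ϖ ≤ 1 := by rw [hϖ, ← WithZero.exp_zero, WithZero.exp_le_exp]; norm_num
  have hc0 : Valued.v (ϖ ^ c) ≠ 0 := by rw [map_pow]; exact pow_ne_zero _ hϖ0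
  -- `|ϖ^c| · |x r| ≤ |ϖ^{h+1}| = |ϖ^c| · |ϖ^{h+1-c}|`
  have h1 : Valued.v (ϖ ^ c) * Valued.v (x * r) ≤ Valued.v (ϖ ^ c) * Valued.v (ϖ ^ (h + 1 - c)) := by
    calc Valued.v (ϖ ^ c) * Valued.v (x * r) = Valued.v (ϖ ^ c * x) * Valued.v r := by rw [map_mul, map_mul, mul_assoc]
      _ ≤ 1 * Valued.v (ϖ ^ (h + 1)) := mul_le_mul' hx hr
      _ = Valued.v (ϖ ^ c) * Valued.v (ϖ ^ (h + 1 - c)) := by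
          rw [one_mul, ← map_mul, ← pow_add]; congr 2; omega
  have h2 : Valued.v (x * r) ≤ Valued.v (ϖ ^ (h + 1 - c)) := by
    have := mul_le_mul' (le_refl (Valued.v (ϖ ^ c))⁻¹) h1
    rwa [inv_mul_cancel_left₀ hc0, inv_mul_cancel_left₀ hc0] at this
  have h3 : Valued.v (ϖ ^ (h + 1 - c)) ≤ Valued.v (ϖ ^ j) := by
    rw [map_pow, map_pow]; exact pow_le_pow_right_of_le_one' hϖ1 (by omega)
  have h4 : Valued.v (x * r) ≤ Valued.v (ϖ ^ j) := h2.trans h3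
  rw [v_le_iff_valuation_le] at h4
  rwa [map_pow] at h4

/-- Transport of an entry bound along a non-expanding root value: `|r| ≤ 1 ⇒ valuation(x · r) ≤ valuation(x)` (and so `≤ γ` if `valuation x ≤ γ`).
[cite: HarishChandra1970, Part VII §8 p. 81] -/
theorem valuation_mul_le_of_v_le_one {x r : K} {γ : ValueGroupWithZero K} (hx : valuation K x ≤ γ) (hr : Valued.v r ≤ 1) : valuation K (x * r) ≤ γ := by
  rw [v_le_one_iff_valuation_le_one] at hr
  rw [map_mul]
  calc valuation K x * valuation K r ≤ γ * 1 := mul_le_mul' hx hr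
    _ = γ := mul_one γ

end Level

end Summit.HodgeConjecture.HodgeConjecture.Cruxes.H413.K2E3CuspFormCancellationU3Torus

end
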